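import Summits.BirchSwinnertonDyer.BirchSwinnertonDyer.Theorems.CMKolyvaginAtInertTwoShaCountTwistModelAtTwo
import Literature.NumberTheory.EllipticCurves.SerreOpenImageOrdinaryInertiaProofs
import Literature.NumberTheory.QuadraticFields.KroneckerSplitting
import HarnessLib

/-!
# Route `CMKolyvaginAtInertTwo`, crux `CMKolyvaginExactAtInertTwo` (stmt-BirchSwinnertonDyer-24277):
# THE COUNT IDENTITY, X — `(Δ_E / q) = sign Δ_E` on every PRIME Heegner field `ℚ(√−q)`, by
# quadratic reciprocity alone (no CM): the habitat binder `(Δ_E/q) = −1` of file IV IS `Δ_E < 0`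

Seat `bsd-line-cmk2-p1` g15 (cell `bsd-print-cf2`); helper (`--supports stmt-BirchSwinnertonDyer-24277`).
THEOREMS ONLY: no definition, no named fact, no `sorry`; no item is closed; BSD is not proved by this.

File VII derived `(Δ_E/q) = −1` on H₂ from the CM structure (`Δ = d_F s²`, `q` inert in `F`). It is
in fact a consequence of the Heegner hypothesis ALONE, for every globally minimal `W/ℚ` and every
imaginary quadratic `K` with odd prime `|d_K| = q` in which all bad primes of `W` split: every prime
`p ∣ Δ_min` divides `N`, hence splits in `K = ℚ(√−q)`, i.e. `(−q/p) = 1` (`p` odd) resp.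
`q ≡ 7 (mod 8)` (`p = 2`); since `q ≡ 3 (mod 4)`, reciprocity turns `(−q/p) = 1` into `(p/q) = 1` in
both residue classes of `p mod 4`, and `(2/q) = 1`; so `(|Δ_min|/q) = 1` and
**`(Δ_min/q) = (sign Δ_min / q) = sign Δ_min`** (`(−1/q) = −1`). Consequences: on `Δ < 0` (the
`R`-habitats of this line AND of `GenusKolyvaginAtTwo`, CM or not) `c_q(E^{(d_K)}) = 2` exactly and
file IV's count identity holds; on `Δ > 0` (gk2's `T`-habitats) `(Δ/q) = +1`, `c_q(E^{(d_K)}) ∈ {1, 4}`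
and the identity picks up `ord₂ c_q(E^{(d_K)}) ∈ {0, 2}` instead (see `…ShaCountAtTwo` with
`…TamagawaTwistAtTwo`: `ord₂ #Ш(E_K) = ord₂ #Ш(E) + ord₂ #Ш(E_d) + ord₂ c_q(E_d) + [Δ>0] − 1`).

* `legendreSym_natAbs_discr_eq_one_of_prime_dvd_conductorNorm` — `(p/q) = 1` for every prime
  `p ∣ N` (as `jacobiSym p q = 1`);
* `jacobiSym_natCast_eq_one_of_forall_prime` — multiplicativity bookkeeping;
* `jacobiSym_minimalDiscriminantInt_natAbs_discr` — **`(Δ_min/q) = if Δ < 0 then −1 else 1`**;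
* `jacobiSym_num_Δ_eq_neg_one_of_Δ_neg_of_heegner_prime` — `Δ < 0 ⟹ (Δ/q) = −1` (file IV's binder).

References: Ireland–Rosen, Thm. 5.1 and Prop. 5.1.3 (reciprocity, supplements), Prop. 13.1.3
(decomposition law); Gross 1991 §2 (Heegner hypothesis); Kramer 1981 Prop. 3.
-/

-- single-conjunct summit: `Summit.BirchSwinnertonDyer.BirchSwinnertonDyer.…` repeats the name by design
set_option linter.dupNamespace false
set_option autoImplicit false

noncomputable section

open scoped Classical

open WeierstrassCurve NumberField Literature.NumberTheory.EllipticCurves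
  Literature.NumberTheory.QuadraticFields Summit.BirchSwinnertonDyer.Rank1Residual

namespace Summit.BirchSwinnertonDyer.BirchSwinnertonDyer.Theorems.ShaCountTwo

/-! ## §1 Multiplicativity bookkeeping -/

/-- If `jacobiSym p q = 1` for every prime `p ∣ n` (`n ≠ 0`), then `jacobiSym n q = 1`
(multiplicativity in the numerator, induction on `n`). [folklore] -/
theorem jacobiSym_natCast_eq_one_of_forall_prime (q : ℕ) {n : ℕ} (hn : n ≠ 0)
    (h : ∀ p : ℕ, p.Prime → p ∣ n → jacobiSym (p : ℤ) q = 1) : jacobiSym (n : ℤ) q = 1 := by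
  induction n using Nat.strong_induction_on with
  | _ n ih =>
    rcases Nat.lt_or_ge n 2 with hlt | hge
    · have h1 : n = 1 := by omega
      subst h1
      rw [Nat.cast_one, jacobiSym.one_left]
    · set p := n.minFac with hp_def
      have hp : p.Prime := Nat.minFac_prime (by omega)
      obtain ⟨m, hm⟩ : p ∣ n := Nat.minFac_dvd n
      have hm0 : m ≠ 0 := by
        rintro rfl
        rw [mul_zero] at hm
        exact hn hm
      have hmlt : m < n := by
        have h2 := hp.two_le
        rcases Nat.eq_or_lt_of_le (Nat.le_of_dvd (Nat.pos_of_ne_zero hn) ⟨p, by rw [hm, mul_comm]⟩)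
          with h | h
        · exfalso
          rw [h] at hm
          have : p = 1 := by
            have := hm
            nth_rw 1 [← one_mul n] at this
            exact (Nat.eq_of_mul_eq_mul_right (Nat.pos_of_ne_zero hn) this).symm
          exact hp.one_lt.ne' this
        · exact h
      rw [hm, Nat.cast_mul, jacobiSym.mul_left, h p hp ⟨m, hm⟩, one_mul]
      exact ih m hmlt hm0 fun r hr hrm ↦ h r hr (hm ▸ Dvd.dvd.mul_left hrm p)

/-! ## §2 `(p/q) = 1` for the bad primes, `(Δ_min/q) = sign Δ_min` -/

section Heegner

variable (W : WeierstrassCurve ℚ) [W.IsElliptic] [W.IsGloballyMinimal]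
  (K : Type) [Field K] [NumberField K] (hK : IsImaginaryQuadratic K)
  (hodd : Odd (NumberField.discr K)) (hH : SatisfiesHeegnerHypothesis (W.conductorNorm ℤ) K)
  (hq : (NumberField.discr K).natAbs.Prime)

omit [W.IsElliptic] [W.IsGloballyMinimal] in
include hK hodd hH hq in
/-- **`(p/q) = 1` for every prime `p ∣ N` on a prime Heegner field `ℚ(√−q)`.** The bad prime `p`
splits in `K` (Heegner hypothesis). If `p = 2`: `d_K = −q ≡ 1 (mod 8)` (decomposition law at `2`),
so `q ≡ 7 (mod 8)` and `(2/q) = χ₈(q) = 1`. If `p` is odd: `(−q/p) = 1` (decomposition law), i.e.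
`(q/p) = (−1/p)`; `q ≡ 3 (mod 4)`, so reciprocity gives `(p/q) = (q/p)` if `p ≡ 1 (4)` and
`(p/q) = −(q/p)` if `p ≡ 3 (4)` — in both cases `(p/q) = 1`. (`p ≠ q`: `q` ramifies, so it does not
split, so `q ∤ N`.) [folklore] -/
theorem legendreSym_natAbs_discr_eq_one_of_prime_dvd_conductorNorm {p : ℕ} (hp : p.Prime)
    (hpN : p ∣ W.conductorNorm ℤ) : jacobiSym (p : ℤ) (NumberField.discr K).natAbs = 1 := by
  set q : ℕ := (NumberField.discr K).natAbs with hq_def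
  haveI hqF : Fact q.Prime := ⟨hq⟩
  haveI hpF : Fact p.Prime := ⟨hp⟩
  have h2 : Module.finrank ℚ K = 2 := hK.1
  have hq4 : q % 4 = 3 := natAbs_discr_mod_four K hK hodd
  have hDq : NumberField.discr K = -(q : ℤ) := discr_eq_neg_natAbs K hK
  have hq2 : q ≠ 2 := by omega
  have hsplit : ((Ideal.span {(p : ℤ)}).primesOver (𝓞 K)).ncard = 2 := hH p hp hpN
  -- `p ≠ q`: `q` ramifies (`q ∣ d_K`), so it does not split
  have hpq : p ≠ q := by
    intro h
    have hsplitq : ((Ideal.span {(q : ℤ)}).primesOver (𝓞 K)).ncard = 2 := by rw [← h]; exact hsplit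
    have hleg := (Quadratic.ncard_primesOver_eq_two_iff_legendreSym h2 hq2).mp hsplitq
    have h0 : legendreSym q (NumberField.discr K) = 0 := by
      rw [legendreSym.eq_zero_iff, hDq]
      simp
    rw [h0] at hleg
    exact zero_ne_one hleg
  rw [← jacobiSym.legendreSym.to_jacobiSym]
  by_cases hp2 : p = 2
  · -- `2 ∣ N`: `d_K ≡ 1 (mod 8)`, `q ≡ 7 (mod 8)`, `(2/q) = 1`
    have hsplit2 : ((Ideal.span {(2 : ℤ)}).primesOver (𝓞 K)).ncard = 2 := by
      rw [hp2] at hsplit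
      exact_mod_cast hsplit
    have h8 : NumberField.discr K % 8 = 1 := (Quadratic.ncard_primesOver_two_eq_two_iff h2).mp hsplit2
    have hq8 : q % 8 = 7 := by omega
    rw [hp2, Nat.cast_ofNat, legendreSym.at_two hq2, ZMod.χ₈_nat_eq_if_mod_eight]
    have : q % 2 ≠ 0 := by omega
    simp [this, hq8]
  · -- odd `p`: `(−q/p) = 1`, reciprocity
    have hleg : legendreSym p (NumberField.discr K) = 1 :=
      (Quadratic.ncard_primesOver_eq_two_iff_legendreSym h2 hp2).mp hsplit
    rw [hDq] at hleg
    have hmul : legendreSym p (-(q : ℤ)) = legendreSym p (-1) * legendreSym p q := by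
      rw [← legendreSym.mul]; ring_nf
    rw [hmul, legendreSym.at_neg_one hp2] at hleg
    rcases Nat.odd_mod_four_iff.mp (hp.eq_two_or_odd.resolve_left hp2) with hp1 | hp3
    · -- `p ≡ 1 (4)`: `(q/p) = 1`, `(p/q) = (q/p)`
      rw [ZMod.χ₄_nat_one_mod_four hp1, one_mul] at hleg
      rw [legendreSym.quadratic_reciprocity_one_mod_four hp1 hq2]
      exact hleg
    · -- `p ≡ 3 (4)`: `(q/p) = -1`, `(p/q) = -(q/p)`
      rw [ZMod.χ₄_nat_three_mod_four hp3, neg_one_mul] at hleg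
      rw [legendreSym.quadratic_reciprocity_three_mod_four hp3 hq4]
      exact hleg

include hK hodd hH hq in
/-- **`(Δ_min/q) = sign Δ_min` on a prime Heegner field `ℚ(√−q)`** (`W/ℚ` globally minimal; `q` odd
prime with `d_K = −q`, every prime of `N(W)` split in `K`): every prime factor of `Δ_min` is a bad
prime, hence divides `N`, hence has `(p/q) = 1`; so `(|Δ_min|/q) = 1` and
`(Δ_min/q) = (−1/q)^{[Δ<0]} = (if Δ < 0 then −1 else 1)` (`q ≡ 3 (mod 4)`). [folklore] -/
theorem jacobiSym_minimalDiscriminantInt_natAbs_discr :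
    jacobiSym (minimalDiscriminantInt W) (NumberField.discr K).natAbs = if W.Δ < 0 then -1 else 1 := by
  set q : ℕ := (NumberField.discr K).natAbs with hq_def
  haveI hqF : Fact q.Prime := ⟨hq⟩
  have hq4 : q % 4 = 3 := natAbs_discr_mod_four K hK hodd
  set Δm : ℤ := minimalDiscriminantInt W with hΔm_def
  have hcast : (Δm : ℚ) = W.Δ := cast_minimalDiscriminantInt W
  have hΔ0 : Δm ≠ 0 := by
    intro h
    have : W.Δ = 0 := by rw [← hcast, h, Int.cast_zero]
    exact W.Δ'.ne_zero (by rw [coe_Δ']; exact this)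
  -- `(|Δ_min|/q) = 1`
  have habs : jacobiSym (Δm.natAbs : ℤ) q = 1 := by
    refine jacobiSym_natCast_eq_one_of_forall_prime q (Int.natAbs_ne_zero.mpr hΔ0) fun p hp hpΔ ↦ ?_
    haveI : Fact p.Prime := ⟨hp⟩
    have hpΔ' : (p : ℤ) ∣ Δm := Int.dvd_natAbs.mp (Int.natCast_dvd_natCast.mpr hpΔ)
    have hbad : ¬ W.HasGoodReductionAtPrime p := fun hgood ↦
      not_dvd_minimalDiscriminantInt_of_hasGoodReductionAtPrime' W p hgood hpΔ'
    exact legendreSym_natAbs_discr_eq_one_of_prime_dvd_conductorNorm W K hK hodd hH hq hp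
      ((W.dvd_conductorNorm_iff_not_hasGoodReductionAtPrime p).mpr hbad)
  have hqodd : Odd q := by rw [Nat.odd_iff]; omega
  by_cases hneg : W.Δ < 0
  · rw [if_pos hneg]
    have hΔneg : Δm < 0 := by
      have : (Δm : ℚ) < 0 := by rw [hcast]; exact hneg
      exact_mod_cast this
    have hΔeq : Δm = -(Δm.natAbs : ℤ) := by
      rw [Int.ofNat_natAbs_of_nonpos hΔneg.le, neg_neg]
    rw [hΔeq, jacobiSym.neg _ hqodd, habs, mul_one, ZMod.χ₄_nat_three_mod_four hq4]
  · rw [if_neg hneg]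
    have hΔpos : 0 ≤ Δm := by
      have : (0 : ℚ) ≤ Δm := by rw [hcast]; exact not_lt.mp hneg
      exact_mod_cast this
    have hΔeq : Δm = (Δm.natAbs : ℤ) := (Int.natAbs_of_nonneg hΔpos).symm
    rw [hΔeq, habs]

include hK hodd hH hq in
/-- **`Δ < 0 ⟹ (Δ/q) = −1` on a prime Heegner field** — file IV's binder `hjac`, for EVERY globally
minimal `W/ℚ` with negative discriminant (CM or not): in particular `c_q(E^{(d_K)}) = #Ẽ(𝔽_q)[2] = 2`
there (Kramer 1981 Prop. 3). `W.Δ.num = Δ_min`. [cite: Kramer1981, Prop. 3] -/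
theorem jacobiSym_num_Δ_eq_neg_one_of_Δ_neg_of_heegner_prime (hΔ : W.Δ < 0) :
    jacobiSym W.Δ.num (NumberField.discr K).natAbs = -1 := by
  have hnum : W.Δ.num = minimalDiscriminantInt W := by
    rw [← cast_minimalDiscriminantInt W, Rat.num_intCast]
  rw [hnum, jacobiSym_minimalDiscriminantInt_natAbs_discr W K hK hodd hH hq, if_pos hΔ]

include hK hodd hH hq in
/-- **`0 < Δ ⟹ (Δ/q) = +1` on a prime Heegner field** (gk2's `T`-habitats): Frobenius at `q` is an
EVEN permutation of `E[2]`, so `c_q(E^{(d_K)}) = #Ẽ(𝔽_q)[2] ∈ {1, 4}` (never `2`).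
[cite: Kramer1981, Prop. 3] -/
theorem jacobiSym_num_Δ_eq_one_of_Δ_pos_of_heegner_prime (hΔ : 0 < W.Δ) :
    jacobiSym W.Δ.num (NumberField.discr K).natAbs = 1 := by
  have hnum : W.Δ.num = minimalDiscriminantInt W := by
    rw [← cast_minimalDiscriminantInt W, Rat.num_intCast]
  rw [hnum, jacobiSym_minimalDiscriminantInt_natAbs_discr W K hK hodd hH hq, if_neg (not_lt.mpr hΔ.le)]

end Heegner

end Summit.BirchSwinnertonDyer.BirchSwinnertonDyer.Theorems.ShaCountTwo

end
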